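import Literature.Probability.LatticeModels.CornerFugacityMeasure
import Mathlib.Analysis.Calculus.Deriv.Basic
import Mathlib.Topology.Order.Basic

/-!
# Sketch (ideator 5, round 2) — crux `CornerLineDescent` (stmt-CriticalPhenomena-10964)

First-lemma sketches for the crux idea card `hyperbola-vertex-jet`:
the isotropic Izergin–Korepin point `(t, b) = (√3/2, ½)` is the VERTEX of the integrable
hyperbola `t² - (b - ½)² = ¾` traced by the `A₂⁽²⁾` family `u ↦ (t u, b u)`,
`t u = √3/(2 sin u)`, `b u = sin (2π/3 - u)/sin u`: `t'(π/2) = 0`, `t''(π/2) = √3/2`,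
`b'(π/2) = -√3/2`, `b''(π/2) = 0`.  Hence, for every event whose probability `P(t, b)` is `C²`
near the vertex (crossing probabilities are polynomial in `b` and rational with positive
denominator in `t`), the chain rule gives the exact JET IDENTITY

  `d²/du² P(t u, b u)|_{u = π/2} = (√3/2) · ∂ₜP(√3/2, ½) + (3/4) · ∂_b² P(√3/2, ½)`.

The left side runs ALONG the Yang–Baxter family (controlled by the route's transport `r2` and the
Kim–Pearce / MDKP anisotropy dictionary `q = exp(-2πδ e^{-iu})`), the first term on the right is
the corner-line Russo sum at the IK end (the germ of CornerIrrelevance), the second is the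
second-order anisotropy (coin-bias) response at fixed `t = t_IK`.
-/

noncomputable section

namespace Summit.CriticalPhenomena.CardyFormulaZ2.Cruxes.CornerLineDescent.IdeatorFive

open Filter Topology
open Literature.Probability.LatticeModels Literature.Probability.RandomPlanarGeometry

/-- The two-parameter corner-fugacity crossing probability `P_R^δ(t, b)` as a function of two REAL
parameters (corner fugacity `t`, clamped to `ℝ≥0`; NE-diagonal coin bias `b`, clamped to `[0,1]`);
both clamps are the identity near the IK vertex `(√3/2, ½)`. -/
def cornerP (R : ConformalRectangle) (δ : ℝ) (x y : ℝ) : ℝ :=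
  cornerCrossingProb x.toNNReal (Set.projIcc (0 : ℝ) 1 zero_le_one y) R δ

/-- `ikCrossingProb u = cornerP (t u) (b u)` with the tree's `ikCornerFugacity`, `ikCoinBias`
(definitional bookkeeping: `ikCornerFugacity u = (√3/(2 sin u)).toNNReal`,
`ikCoinBias u = projIcc (sin (2π/3 - u)/sin u)`). -/
theorem ikCrossingProb_eq_cornerP (u : ℝ) (R : ConformalRectangle) (δ : ℝ) :
    ikCrossingProb u R δ =
      cornerP R δ (Real.sqrt 3 / (2 * Real.sin u)) (Real.sin (2 * Real.pi / 3 - u) / Real.sin u) :=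
  rfl

/-- FIRST LEMMA (exact, finite `δ`, every conformal rectangle): the jet identity at the vertex of
the integrable hyperbola.  Provable now: `cornerP R δ` is real-analytic near `(√3/2, ½)` (finite
Gibbs weights `t^N/Z(t)`, `Z > 0`; coin cylinder probabilities polynomial in `b`), and
`t'(π/2) = 0`, `t''(π/2) = √3/2`, `b'(π/2) = -√3/2`, `b''(π/2) = 0`. -/
def HyperbolaVertexJet : Prop :=
  ∀ (R : ConformalRectangle) (δ : ℝ), 0 < δ →
    deriv (fun u => deriv (fun v => ikCrossingProb v R δ) u) (Real.pi / 2)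
      = (Real.sqrt 3 / 2) * deriv (fun x => cornerP R δ x (1 / 2)) (Real.sqrt 3 / 2)
        + (3 / 4) * deriv (fun y => deriv (fun z => cornerP R δ (Real.sqrt 3 / 2) z) y) (1 / 2)

/-- The germ of CornerIrrelevance at the IK end: the corner-line Russo sum
`∂ₜ P_R^δ(t, ½)|_{t = √3/2}` (`= Σ_f Cov(1_A, κ_f)/t` summed over inner faces) tends to `0`. -/
def CornerGermFlat (R : ConformalRectangle) : Prop :=
  Tendsto (fun δ : ℝ => deriv (fun x => cornerP R δ x (1 / 2)) (Real.sqrt 3 / 2))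
    (𝓝[>] (0 : ℝ)) (𝓝 0)

/-- Second-order anisotropy response of the isotropic IK model: `∂_b² P_R^δ(√3/2, b)|_{b = ½} → a`
(first order vanishes for reflection-symmetric `R`; in general it is odd under `b ↦ 1 - b`). -/
def AnisotropyCurvature (R : ConformalRectangle) (a : ℝ) : Prop :=
  Tendsto (fun δ : ℝ => deriv (fun y => deriv (fun z => cornerP R δ (Real.sqrt 3 / 2) z) y) (1 / 2))
    (𝓝[>] (0 : ℝ)) (𝓝 a)

/-- Curvature of the crossing probability ALONG the integrable `A₂⁽²⁾` family at its isotropic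
point: `d²/du² P_{IK(u)}(R, δ)|_{u = π/2} → c`.  Under the route's transport extended to `u ≠ π/2`
(every `IK(u)` has the site-𝕋 limit up to the linear map `K_u` sending the unit square to the
parallelogram of angle `u` — Kim–Pearce anisotropy angle, MDKP `q = exp(-2πδe^{-iu})`) and
`C²`-interchange of limits, `c = d²/du² Cardy(K_u⁻¹ R)|_{π/2}`, an explicit number. -/
def HyperbolaCurvature (R : ConformalRectangle) (c : ℝ) : Prop :=
  Tendsto (fun δ : ℝ => deriv (fun u => deriv (fun v => ikCrossingProb v R δ) u) (Real.pi / 2))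
    (𝓝[>] (0 : ℝ)) (𝓝 c)

/-- CONSEQUENCE (limit algebra from `HyperbolaVertexJet`): given the hyperbola curvature `c`, the
corner line is flat to first order at IK iff the anisotropy curvature is `(4/3)·c`.  This is what
Yang–Baxter integrability plus `CardyIK` can say about the `t`-direction: second order, at the
vertex only (the hyperbola is tangent to `{t = √3/2}` there and never enters `{t < √3/2}`). -/
def GermEquivalence : Prop :=
  HyperbolaVertexJet →
    ∀ (R : ConformalRectangle) (c : ℝ), HyperbolaCurvature R c →
      (CornerGermFlat R ↔ AnisotropyCurvature R (4 / 3 * c))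

/-- The limit algebra behind `GermEquivalence`, isolated: if `j δ = (√3/2)·g δ + (3/4)·a δ`
eventually and `j → c`, then `g → 0 ↔ a → (4/3)c`. -/
theorem germ_algebra {j g a : ℝ → ℝ} {c : ℝ}
    (hj : ∀ᶠ δ in 𝓝[>] (0 : ℝ), j δ = Real.sqrt 3 / 2 * g δ + 3 / 4 * a δ)
    (hc : Tendsto j (𝓝[>] (0 : ℝ)) (𝓝 c)) :
    Tendsto g (𝓝[>] (0 : ℝ)) (𝓝 0) ↔ Tendsto a (𝓝[>] (0 : ℝ)) (𝓝 (4 / 3 * c)) := by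
  have ha : ∀ᶠ δ in 𝓝[>] (0 : ℝ), a δ = 4 / 3 * (j δ - Real.sqrt 3 / 2 * g δ) := by
    filter_upwards [hj] with δ hδ
    rw [hδ]; ring
  have hg : ∀ᶠ δ in 𝓝[>] (0 : ℝ), g δ = 2 / Real.sqrt 3 * (j δ - 3 / 4 * a δ) := by
    filter_upwards [hj] with δ hδ
    have h3 : Real.sqrt 3 ≠ 0 := by positivity
    rw [hδ]; field_simp; ring
  constructor
  · intro h0
    have h1 : Tendsto (fun δ => 4 / 3 * (j δ - Real.sqrt 3 / 2 * g δ)) (𝓝[>] (0 : ℝ))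
        (𝓝 (4 / 3 * (c - Real.sqrt 3 / 2 * 0))) :=
      (hc.sub (h0.const_mul _)).const_mul _
    rw [mul_zero, sub_zero] at h1
    exact h1.congr' (by filter_upwards [ha] with δ hδ; exact hδ.symm)
  · intro h1
    have h0 : Tendsto (fun δ => 2 / Real.sqrt 3 * (j δ - 3 / 4 * a δ)) (𝓝[>] (0 : ℝ))
        (𝓝 (2 / Real.sqrt 3 * (c - 3 / 4 * (4 / 3 * c)))) :=
      (hc.sub (h1.const_mul _)).const_mul _
    have : 2 / Real.sqrt 3 * (c - 3 / 4 * (4 / 3 * c)) = 0 := by ring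
    rw [this] at h0
    exact h0.congr' (by filter_upwards [hg] with δ hδ; exact hδ.symm)

/-- `GermEquivalence` holds (pure limit algebra on top of the jet identity). -/
theorem germEquivalence_holds : GermEquivalence := by
  intro hjet R c hc
  refine germ_algebra ?_ hc
  filter_upwards [self_mem_nhdsWithin] with δ hδ
  exact hjet R δ hδ

end Summit.CriticalPhenomena.CardyFormulaZ2.Cruxes.CornerLineDescent.IdeatorFive
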